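import Literature.Probability.LatticeModels.DiscreteExtremalLengthExternalArcs
import HarnessLib

/-!
# Rotating the presentation of a discrete topological rectangle by one arc
(line `fk-anchor-transfer` of the crux `SAWLoopFugacityFlow.IsingBoundaryRatio`, stmt-CriticalPhenomena-10650;
helper of the rim-to-rim instance `halfAnnulusRimCrossingBoundLarge_of'` of CDH16 Thm 1.1 (ii))

Chelkak–Duminil-Copin–Hongler 2016, Thm 1.1 (`fkIsing_topologicalRectangle_crossingBounds`) speaks about the
arcs `0` and `2` of a presentation `DiscreteRect.IsRect E d₀ n` (edge set, first external dart, sizes of the four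
arcs of the boundary cycle). To apply it to the OTHER pair of arcs one rotates the presentation: the first dart
becomes `(succ E)^[n 0] d₀` and the sizes become `(n 1, n 2, n 3, n 0)`. This file proves that the rotated data
is again an `IsRect` (`isRect_rotate_rim`), that its arcs `0` / `2` are the old arcs `1` / `3` (`arcVerts_rotate_rim`),
likewise for the external arcs of the completed graph (`extArc_rotate_rim`), so that its external resistance
`ℓ_Ω̄[(arc 0'),(arc 2')]` is the old `ℓ_Ω̄[(arc 1),(arc 3)]` (`extResistance_rotate_rim`). On the way: the
boundary-tracing successor `DiscreteRect.succ` maps external darts to external darts (`isExtDart_succ_rim`),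
by the lattice identities `dir (k + 2) = -dir k`, `dir (k + 1) + dir (k - 1) = 0`.
-/

open Literature.Probability.LatticeModels

namespace Summit.CriticalPhenomena.SAWScalingLimit.Theorems.IsingBoundaryRatio

/-! ### Lattice directions and external darts -/

/-- Opposite directions: `dir (k + 2) = -dir k`. [folklore] -/
theorem dir_add_two_rim (k : Fin 4) : DiscreteRect.dir (k + 2) = -DiscreteRect.dir k := by
  fin_cases k <;> decide

/-- The two directions orthogonal to `dir k` cancel: `dir (k + 1) + dir (k - 1) = 0`. [folklore] -/
theorem dir_add_one_add_dir_sub_one_rim (k : Fin 4) :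
    DiscreteRect.dir (k + 1) + DiscreteRect.dir (k - 1) = 0 := by
  fin_cases k <;> decide

/-- `k - 2 = k + 2` in `Fin 4`. [folklore] -/
theorem fin_four_sub_two_rim (k : Fin 4) : k - 2 = k + 2 := by
  fin_cases k <;> decide

/-- The left endpoint of an edge of `E` is a vertex of `E`. [folklore] -/
theorem mem_verts_of_mem_left_rim {E : Finset (Sym2 (Site 2))} {x y : Site 2} (h : s(x, y) ∈ E) :
    x ∈ DiscreteRect.verts E :=
  Finset.mem_biUnion.2 ⟨s(x, y), h, by simp [DiscreteRect.endpts]⟩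

/-- The right endpoint of an edge of `E` is a vertex of `E`. [folklore] -/
theorem mem_verts_of_mem_right_rim {E : Finset (Sym2 (Site 2))} {x y : Site 2} (h : s(x, y) ∈ E) :
    y ∈ DiscreteRect.verts E :=
  mem_verts_of_mem_left_rim (by rwa [Sym2.eq_swap])

/-- A vertex of `E` is the endpoint of an edge of `E`. [folklore] -/
theorem exists_mem_of_mem_verts_rim {E : Finset (Sym2 (Site 2))} {x : Site 2}
    (h : x ∈ DiscreteRect.verts E) : ∃ y, s(x, y) ∈ E := by
  obtain ⟨e, he, hx⟩ := Finset.mem_biUnion.1 h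
  induction e using Sym2.ind with
  | h a b =>
    simp only [DiscreteRect.endpts, Sym2.lift_mk, Finset.mem_insert, Finset.mem_singleton] at hx
    rcases hx with rfl | rfl
    · exact ⟨b, he⟩
    · exact ⟨a, by rwa [Sym2.eq_swap]⟩

/-- **The successor of an external dart is an external dart** (boundary tracing stays on the boundary).
[folklore] -/
theorem isExtDart_succ_rim {E : Finset (Sym2 (Site 2))} {d : Site 2 × Fin 4} (hd : DiscreteRect.IsExtDart E d) :
    DiscreteRect.IsExtDart E (DiscreteRect.succ E d) := by
  obtain ⟨x, k⟩ := d
  obtain ⟨hx, hk⟩ := hd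
  dsimp only at hx hk
  dsimp only [DiscreteRect.succ]
  split_ifs with h1 h2 h3
  · refine ⟨mem_verts_of_mem_right_rim h3, ?_⟩
    have e1 : x + DiscreteRect.dir (k + 1) + DiscreteRect.dir k + DiscreteRect.dir (k - 1) =
        x + DiscreteRect.dir k := by
      have := dir_add_one_add_dir_sub_one_rim k
      calc x + DiscreteRect.dir (k + 1) + DiscreteRect.dir k + DiscreteRect.dir (k - 1)
          = x + DiscreteRect.dir k + (DiscreteRect.dir (k + 1) + DiscreteRect.dir (k - 1)) := by abel
        _ = x + DiscreteRect.dir k := by rw [this, add_zero]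
    have e2 : x + DiscreteRect.dir k + DiscreteRect.dir (k - 2) = x := by
      rw [fin_four_sub_two_rim, dir_add_two_rim, add_neg_cancel_right]
    dsimp only
    rw [e1, e2, Sym2.eq_swap]
    exact hk
  · exact ⟨mem_verts_of_mem_right_rim h2, h3⟩
  · exact ⟨mem_verts_of_mem_right_rim h1, h2⟩
  · exact ⟨hx, h1⟩

/-- Every dart of the boundary-tracing orbit of an external dart is an external dart. [folklore] -/
theorem isExtDart_iterate_succ_rim {E : Finset (Sym2 (Site 2))} {d : Site 2 × Fin 4}
    (hd : DiscreteRect.IsExtDart E d) (i : ℕ) : DiscreteRect.IsExtDart E ((DiscreteRect.succ E)^[i] d) := by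
  induction i with
  | zero => exact hd
  | succ i ih => rw [Function.iterate_succ_apply']; exact isExtDart_succ_rim ih

/-- The vertices of any arc of a presentation are boundary vertices, in particular vertices of `E`. [folklore] -/
theorem arcVerts_subset_rim {E : Finset (Sym2 (Site 2))} {d₀ : Site 2 × Fin 4} {n : Fin 4 → ℕ}
    (h : DiscreteRect.IsExtDart E d₀) (j : Fin 4) :
    DiscreteRect.arcVerts E d₀ n j ⊆ {x | x ∈ DiscreteRect.verts E ∧ x ∈ DiscreteRect.bdVerts E} := by
  rintro x ⟨i, -, -, rfl⟩
  have := isExtDart_iterate_succ_rim h i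
  exact ⟨this.1, ((DiscreteRect.succ E)^[i] d₀).2, this⟩

/-! ### The rotated presentation -/

/-- **Rotating a presentation by one arc gives a presentation**: first dart `(succ E)^[n 0] d₀`, arc sizes
`(n 1, n 2, n 3, n 0)`. [folklore] -/
theorem isRect_rotate_rim : ∀ {E : Finset (Sym2 (Site 2))} {d₀ : Site 2 × Fin 4} {n : Fin 4 → ℕ}, DiscreteRect.IsRect E d₀ n → DiscreteRect.IsRect E ((DiscreteRect.succ E)^[n 0] d₀) ![n 1, n 2, n 3, n 0] := by
  intro E d₀ n h
  set f := DiscreteRect.succ E with hf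
  set N := n 0 + n 1 + n 2 + n 3 with hN
  have hN' : (![n 1, n 2, n 3, n 0] : Fin 4 → ℕ) 0 + (![n 1, n 2, n 3, n 0] : Fin 4 → ℕ) 1 +
      (![n 1, n 2, n 3, n 0] : Fin 4 → ℕ) 2 + (![n 1, n 2, n 3, n 0] : Fin 4 → ℕ) 3 = N := by
    show n 1 + n 2 + n 3 + n 0 = N
    omega
  have hNpos : 0 < N := by have := h.pos 0; omega
  have hn0 : n 0 ≤ N := by omega
  have hper : Function.IsPeriodicPt f N d₀ := h.periodic
  have hmod : ∀ m, f^[m] d₀ = f^[m % N] d₀ := fun m => (hper.iterate_mod_apply m).symm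
  refine ⟨h.subset_edgeSet, isExtDart_iterate_succ_rim h.isExtDart (n 0), ?_, ?_, ?_, ?_⟩
  · intro j
    fin_cases j
    exacts [h.pos 1, h.pos 2, h.pos 3, h.pos 0]
  · rw [hN', ← Function.iterate_add_apply, hmod (N + n 0), Nat.add_mod_left,
      Nat.mod_eq_of_lt (by have := h.pos 1; omega : n 0 < N)]
  · intro i j hi hj hij
    rw [hN'] at hi hj
    rw [← Function.iterate_add_apply, ← Function.iterate_add_apply, hmod (i + n 0), hmod (j + n 0)] at hij
    have h1 := h.injOn _ _ (Nat.mod_lt _ hNpos) (Nat.mod_lt _ hNpos) hij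
    have h2 : i % N = j % N := Nat.ModEq.add_right_cancel' (n 0) h1
    rwa [Nat.mod_eq_of_lt hi, Nat.mod_eq_of_lt hj] at h2
  · intro d hd
    obtain ⟨i, hi, he⟩ := h.cover d hd
    refine ⟨(i + (N - n 0)) % N, by rw [hN']; exact Nat.mod_lt _ hNpos, ?_⟩
    rw [← Function.iterate_add_apply, hmod ((i + (N - n 0)) % N + n 0), Nat.mod_add_mod,
      show i + (N - n 0) + n 0 = i + N by omega, Nat.add_mod_right, Nat.mod_eq_of_lt hi, ← he]

/-- **The arcs `0` and `2` of the rotated presentation are the old arcs `1` and `3`.** [folklore] -/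
theorem arcVerts_rotate_rim (E : Finset (Sym2 (Site 2))) (d₀ : Site 2 × Fin 4) (n : Fin 4 → ℕ) :
    DiscreteRect.arcVerts E ((DiscreteRect.succ E)^[n 0] d₀) ![n 1, n 2, n 3, n 0] 0 =
        DiscreteRect.arcVerts E d₀ n 1 ∧
      DiscreteRect.arcVerts E ((DiscreteRect.succ E)^[n 0] d₀) ![n 1, n 2, n 3, n 0] 2 =
        DiscreteRect.arcVerts E d₀ n 3 := by
  constructor
  · ext x
    simp only [DiscreteRect.arcVerts, Set.mem_setOf_eq]
    show (∃ i, 0 ≤ i ∧ i < 0 + n 1 ∧ _) ↔ ∃ i, n 0 ≤ i ∧ i < n 0 + n 1 ∧ _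
    constructor
    · rintro ⟨i, -, hi, rfl⟩
      exact ⟨i + n 0, by omega, by omega, by rw [Function.iterate_add_apply]⟩
    · rintro ⟨i, hi, hi', rfl⟩
      refine ⟨i - n 0, by omega, by omega, ?_⟩
      rw [← Function.iterate_add_apply, Nat.sub_add_cancel hi]
  · ext x
    simp only [DiscreteRect.arcVerts, Set.mem_setOf_eq]
    show (∃ i, n 1 + n 2 ≤ i ∧ i < n 1 + n 2 + n 3 ∧ _) ↔
      ∃ i, n 0 + n 1 + n 2 ≤ i ∧ i < n 0 + n 1 + n 2 + n 3 ∧ _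
    constructor
    · rintro ⟨i, hi, hi', rfl⟩
      exact ⟨i + n 0, by omega, by omega, by rw [Function.iterate_add_apply]⟩
    · rintro ⟨i, hi, hi', rfl⟩
      refine ⟨i - n 0, by omega, by omega, ?_⟩
      rw [← Function.iterate_add_apply, Nat.sub_add_cancel (by omega : n 0 ≤ i)]

/-- **The external arcs `0` and `2` of the rotated presentation are the old external arcs `1` and `3`.**
[folklore] -/
theorem extArc_rotate_rim (E : Finset (Sym2 (Site 2))) (d₀ : Site 2 × Fin 4) (n : Fin 4 → ℕ) :
    DiscreteRect.extArc E ((DiscreteRect.succ E)^[n 0] d₀) ![n 1, n 2, n 3, n 0] 0 =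
        DiscreteRect.extArc E d₀ n 1 ∧
      DiscreteRect.extArc E ((DiscreteRect.succ E)^[n 0] d₀) ![n 1, n 2, n 3, n 0] 2 =
        DiscreteRect.extArc E d₀ n 3 := by
  constructor
  · ext v
    simp only [DiscreteRect.extArc, Set.mem_setOf_eq]
    show (∃ i, 0 ≤ i ∧ i < 0 + n 1 ∧ _) ↔ ∃ i, n 0 ≤ i ∧ i < n 0 + n 1 ∧ _
    constructor
    · rintro ⟨i, -, hi, rfl⟩
      exact ⟨i + n 0, by omega, by omega, by rw [Function.iterate_add_apply]⟩
    · rintro ⟨i, hi, hi', rfl⟩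
      refine ⟨i - n 0, by omega, by omega, ?_⟩
      rw [← Function.iterate_add_apply, Nat.sub_add_cancel hi]
  · ext v
    simp only [DiscreteRect.extArc, Set.mem_setOf_eq]
    show (∃ i, n 1 + n 2 ≤ i ∧ i < n 1 + n 2 + n 3 ∧ _) ↔
      ∃ i, n 0 + n 1 + n 2 ≤ i ∧ i < n 0 + n 1 + n 2 + n 3 ∧ _
    constructor
    · rintro ⟨i, hi, hi', rfl⟩
      exact ⟨i + n 0, by omega, by omega, by rw [Function.iterate_add_apply]⟩
    · rintro ⟨i, hi, hi', rfl⟩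
      refine ⟨i - n 0, by omega, by omega, ?_⟩
      rw [← Function.iterate_add_apply, Nat.sub_add_cancel (by omega : n 0 ≤ i)]

/-- **The external resistance between the arcs `0`, `2` of the rotated presentation is `ℓ_Ω̄[(arc 1),(arc 3)]`
of the original one.** [folklore] -/
theorem extResistance_rotate_rim (E : Finset (Sym2 (Site 2))) (d₀ : Site 2 × Fin 4) (n : Fin 4 → ℕ) :
    DiscreteRect.extResistance E ((DiscreteRect.succ E)^[n 0] d₀) ![n 1, n 2, n 3, n 0] 0 2 =
      DiscreteRect.extResistance E d₀ n 1 3 := by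
  unfold DiscreteRect.extResistance
  rw [(extArc_rotate_rim E d₀ n).1, (extArc_rotate_rim E d₀ n).2]

end Summit.CriticalPhenomena.SAWScalingLimit.Theorems.IsingBoundaryRatio
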